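import Literature.InformationTheory.QuantumCodes.CSSThresholdConverses
import Literature.InformationTheory.QuantumCodes.CSSEquivalenceNoise
import HarnessLib

/-!
# Maximum-likelihood (degenerate, coset) decoding is optimal; the optimal failure probability of a code

Topic `Literature/InformationTheory/QuantumCodes` (venture QEC, LADDER-QEC rungs Q4/Q5; qec-lit-2 gen 5). Theorem-only
companion of `SyndromeDecoding.lean` (decoders `D : Syn → Err`, `D.Corrects syn S e ↔ D (syn e) + e ∈ S`) and of the
noise functionals of `CodeCapacityNoise.lean` / `CSSThresholdConverses.lean`. No named fact, no `sorry`.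

**Printed statements.** Dennis–Kitaev–Landahl–Preskill 2002, §4.3: given the measured syndrome `S`, "the probability
that the syndrome was caused by any error chain `E' = S + C'` such that `C'` belongs to the homology class `h` is
`prob(h|S) = Σ_{C' ∈ h} prob(S + C') / Σ_{C'} prob(S + C')`" (eq. (prob_homol)); "Clearly, then, given a measured
syndrome `S`, the optimal way to recover is to guess that the homology class `h` of `C` is the class with the highest
probability according to eq. (prob_homol). Recovery succeeds if `C` belongs to this class, and fails otherwise."; §4.7:
recovering by the minimum-WEIGHT chain instead ("minimizing energy rather than free energy") is a different procedure
whose critical error rate "provides a lower bound on `p_c`". Bravyi–Suchara–Vargo 2014, §1–§2: "the maximum likelihood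
decoder (MLD) is an algorithm that finds a recovery operation maximizing the probability of a successful error correction
conditioned on the observed error syndrome. By definition, MLD is the optimal error correction algorithm for a fixed
quantum code and a fixed noise model"; the coset probability `π(fG) = Σ_{g ∈ G} π(fg)`; ML Decoder: "`C_ML^s ← argmax_C
π(C)` … any `g ∈ C_ML^s`"; "the best possible error correction algorithm for this effective noise model is to choose a
recovery operator as … any Pauli operator that belongs to the most likely of the … cosets".

**What is proved here** (the elementary optimality behind "by definition", for the tree's combinatorial decoders and
an ARBITRARY real weight `w` on a finite error set — independent flips `p^{|e|}(1-p)^{n-|e|}` are the case used by the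
census):

* `Decoder.classMass w syn S s c = Σ_{e : syn e = s, c + e ∈ S} w e` — the mass of the syndrome-`s` errors that the
  correction `c` repairs (for a stabilizer SUBGROUP `S` it depends only on the class of `c` modulo `S`:
  `classMass_eq_of_sub_mem`; it is DKLP's numerator `Σ_{C' ∈ h} prob(S + C')`, BSV's coset probability);
* `Decoder.successMass` / `failureMass` (`Σ_{e : D corrects e} w e`, `Σ_{e : D fails on e} w e`) and the decomposition
  `successMass D = Σ_s classMass s (D s)` over the occurring syndromes (`successMass_eq_sum_classMass`);
* `Decoder.IsMaxLikelihood w syn S D`: on every syndrome `D` returns a correction of maximal class mass (the printed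
  `argmax`); such decoders exist on a finite error set (`isMaxLikelihood_mlDecoder`);
* **optimality** `IsMaxLikelihood.successMass_le` / `failureMass_le`: EVERY decoder `D'` has
  `failureMass (ML) ≤ failureMass D'`; two ML decoders have the same failure mass; the common value is
  `Decoder.optimalFailureMass w syn S` (`= ⊓` over decoders: `optimalFailureMass_le`, `optimalFailureMass_eq_of_isMaxLikelihood`);
* CSS sectors under independent flips of rate `p` (`CSSCode.zOptimalFailure C p`, `xOptimalFailure` = the `Z`-one of
  `C.swap`): `≤` the failure probability of every decoder (`zOptimalFailure_le`), attained by an ML decoder, in `[0,1]` for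
  `0 ≤ p ≤ 1`, and the decoder-free forms of the tree's code-level CEILINGS: `P^Z_{2p}[erasure uncorrectable] ≤
  2 · zOptimalFailure C p` (erasure decomposition) and, for `k ≥ 1`, `1/2 ≤ zOptimalFailure C p + xOptimalFailure C (1/2 - p)`,
  `1/2 ≤ zOptimalFailure C (1/2)` — the converse bounds hold for the OPTIMAL decoder because they hold for every decoder.

Consequences packaged problem-side (`Summits/Ventures/QEC/Thresholds/OptimalDecoderThresholds.lean`): the OPTIMAL accuracy
threshold of a code family is a well-defined, decoder-free number bounded below by every decoder family's certified
threshold (DKLP §4.7) and above by the every-decoder ceilings.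

Design notes. (1) Nothing is assumed about `syn`, `S`, `w`: optimality is the statement that for each syndrome value the
ML rule maximises the summand, so it holds for signed weights too; non-negativity (`0 ≤ p ≤ 1`) enters only the bounds
`0 ≤ failureMass ≤ Σ w`. (2) The ML decoder depends on the noise (`w`, i.e. on `p`): the optimal failure probability of a
family is `(i, p) ↦ optimalFailureMass (w_p) …`, an infimum over decoders taken rate by rate — exactly DKLP's `p_c`.
(3) Deliberately NOT here: the statistical-mechanics dictionary (free energy, Nishimori line), any numerical value
(`p_c ≈ .1094`, VALIDATED column), the complexity of ML decoding (`CSSDistanceHardness.lean` has the hardness of coset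
weights), Pauli-valued (depolarising) noise with `X/Z` correlations.

## References

* [DennisEtAl2002] E. Dennis, A. Kitaev, A. Landahl, J. Preskill, *Topological quantum memory*, J. Math. Phys. 43 (2002)
  4452, arXiv:quant-ph/0110143 (held `paper:arxiv-quant-ph_0110143`): §4.3 eq. (prob_homol) and the sentence after it
  (chunk p0013 L13–L20); §4.6 (`p_c`); §4.7 (energy vs free energy; "provides a lower bound on `p_c`", chunk p0018 L28–L34).
* [BravyiSucharaVargo2014] S. Bravyi, M. Suchara, A. Vargo, *Efficient algorithms for maximum likelihood decoding in the
  surface code*, Phys. Rev. A 90 (2014) 032326, arXiv:1405.4883 (held `paper:arxiv-1405.4883`): §1 (chunk p0003 L18–L23),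
  §2 (coset probability, chunk p0005 L46–L54; ML Decoder box and "the best possible error correction algorithm",
  chunk p0005 L130–L141, p0006 L9–L11).
* [RichardsonUrbanke2008] T. Richardson, R. Urbanke, *Modern Coding Theory*, CUP 2008, Lemma 4.78 (erasure decomposition).
-/

namespace Literature.InformationTheory.QuantumCodes

open Finset Matrix

namespace Decoder

/-! ### Abstract layer: class masses, success and failure mass of a decoder -/

section Abstract

universe u v

variable {Err : Type u} {Syn : Type v} [Fintype Err]

open Classical in
/-- The **class mass** of the correction `c` on the syndrome `s` (weight `w`): the total weight of the errors `e` with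
syndrome `s` that `c` repairs (`c + e ∈ S`) — DKLP's `Σ_{C' ∈ h} prob(S + C')`, Bravyi–Suchara–Vargo's coset probability
`π(fG) = Σ_{g ∈ G} π(fg)` of the coset selected by `c`. [cite: DennisEtAl2002, §4.3 eq. (prob_homol)] -/
noncomputable def classMass [Add Err] (w : Err → ℝ) (syn : Err → Syn) (S : Set Err) (s : Syn) (c : Err) : ℝ :=
  ∑ e ∈ univ.filter (fun e : Err => syn e = s ∧ c + e ∈ S), w e

open Classical in
/-- The **success mass** of a decoder: the total weight of the errors it corrects ("Recovery succeeds if `C` belongs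
to this class"). [cite: DennisEtAl2002, §4.3 (after eq. (prob_homol))] -/
noncomputable def successMass [Add Err] (w : Err → ℝ) (syn : Err → Syn) (S : Set Err) (D : Decoder Syn Err) : ℝ :=
  ∑ e ∈ univ.filter (fun e : Err => D.Corrects syn S e), w e

open Classical in
/-- The **failure mass** of a decoder: the total weight of the errors it does not correct ("… and fails otherwise");
for `w e = p^{|e|}(1-p)^{n-|e|}` this is the failure probability whose vanishing defines the threshold.
[cite: DennisEtAl2002, §4.3 (after eq. (prob_homol)) and eq. (ec_cond)] -/
noncomputable def failureMass [Add Err] (w : Err → ℝ) (syn : Err → Syn) (S : Set Err) (D : Decoder Syn Err) : ℝ :=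
  ∑ e ∈ univ.filter (fun e : Err => ¬ D.Corrects syn S e), w e

variable [Add Err] (w : Err → ℝ) (syn : Err → Syn) (S : Set Err)

open Classical in
/-- `success + failure = total weight` (`= 1` for a probability distribution).
[cite: DennisEtAl2002, §4.3 (recovery succeeds … and fails otherwise)] -/
theorem successMass_add_failureMass (D : Decoder Syn Err) :
    successMass w syn S D + failureMass w syn S D = ∑ e, w e := by
  unfold successMass failureMass
  exact sum_filter_add_sum_filter_not _ _ _

open Classical in
/-- `failure = total - success`. [cite: DennisEtAl2002, §4.3 (recovery succeeds … and fails otherwise)] -/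
theorem failureMass_eq_sub (D : Decoder Syn Err) :
    failureMass w syn S D = (∑ e, w e) - successMass w syn S D := by
  rw [← successMass_add_failureMass w syn S D]; ring

open Classical in
/-- **Decomposition of the success mass over syndromes**: `Σ_{D corrects e} w e = Σ_s classMass s (D s)`, the sum over
the occurring syndromes of the mass of the class selected by `D` (the denominator-free form of summing
`prob(h_D(S) | S) · prob(S)` over `S`). [cite: DennisEtAl2002, §4.3 eq. (prob_homol)] -/
theorem successMass_eq_sum_classMass (D : Decoder Syn Err) :
    successMass w syn S D = ∑ s ∈ univ.image syn, classMass w syn S s (D s) := by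
  unfold successMass classMass
  rw [← sum_fiberwise_of_maps_to (s := univ.filter fun e : Err => D.Corrects syn S e) (t := univ.image syn)
    (g := syn) (fun e _ => mem_image_of_mem syn (mem_univ e))]
  refine sum_congr rfl fun s _ => ?_
  refine sum_congr ?_ fun _ _ => rfl
  ext e
  simp only [mem_filter, mem_univ, true_and, Decoder.Corrects]
  constructor
  · rintro ⟨h, rfl⟩; exact ⟨rfl, h⟩
  · rintro ⟨rfl, h⟩; exact ⟨h, rfl⟩

/-- A **maximum-likelihood decoder** (for the weight `w`): on every syndrome it returns a correction whose class mass
is maximal among all corrections — "`C_ML^s ← argmax_C π(C)` … any `g ∈ C_ML^s`"; "guess that the homology class … is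
the class with the highest probability". (definition)
[cite: BravyiSucharaVargo2014, §2 (ML Decoder)] -/
def IsMaxLikelihood (D : Decoder Syn Err) : Prop :=
  ∀ (s : Syn) (c : Err), classMass w syn S s c ≤ classMass w syn S s (D s)

open Classical in
/-- **Maximum-likelihood decoding is optimal**: an ML decoder corrects at least as much weight as ANY decoder
("finds a recovery operation maximizing the probability of a successful error correction conditioned on the observed
error syndrome … MLD is the optimal error correction algorithm for a fixed quantum code and a fixed noise model").
[cite: BravyiSucharaVargo2014, §1–§2; DennisEtAl2002, §4.3 (the optimal way to recover)] -/
theorem IsMaxLikelihood.successMass_le {D : Decoder Syn Err} (hD : IsMaxLikelihood w syn S D) (D' : Decoder Syn Err) :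
    successMass w syn S D' ≤ successMass w syn S D := by
  rw [successMass_eq_sum_classMass, successMass_eq_sum_classMass]
  exact sum_le_sum fun s _ => hD s (D' s)

open Classical in
/-- **Maximum-likelihood decoding is optimal, failure form**: `failureMass (ML) ≤ failureMass D'` for EVERY decoder `D'`.
[cite: BravyiSucharaVargo2014, §1 (MLD is the optimal error correction algorithm); DennisEtAl2002, §4.3] -/
theorem IsMaxLikelihood.failureMass_le {D : Decoder Syn Err} (hD : IsMaxLikelihood w syn S D) (D' : Decoder Syn Err) :
    failureMass w syn S D ≤ failureMass w syn S D' := by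
  rw [failureMass_eq_sub, failureMass_eq_sub]
  linarith [hD.successMass_le w syn S D']

open Classical in
/-- Two ML decoders (different tie-breaking, different coset representatives) fail with the same total weight.
[cite: BravyiSucharaVargo2014, §2 (any g ∈ C_ML^s)] -/
theorem IsMaxLikelihood.failureMass_eq {D D' : Decoder Syn Err} (hD : IsMaxLikelihood w syn S D)
    (hD' : IsMaxLikelihood w syn S D') : failureMass w syn S D = failureMass w syn S D' :=
  le_antisymm (hD.failureMass_le w syn S D') (hD'.failureMass_le w syn S D)

/-- **Existence / the ML decoder**: on a finite non-empty error set pick, for each syndrome, a correction of maximal class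
mass (the printed `argmax`; ties broken by choice). [cite: BravyiSucharaVargo2014, §2 (ML Decoder)] -/
noncomputable def mlDecoder [Nonempty Err] : Decoder Syn Err := fun s =>
  Classical.choose (exists_max_image univ (classMass w syn S s) univ_nonempty)

/-- The ML decoder is a maximum-likelihood decoder. [cite: BravyiSucharaVargo2014, §2 (ML Decoder)] -/
theorem isMaxLikelihood_mlDecoder [Nonempty Err] : IsMaxLikelihood w syn S (mlDecoder w syn S) := fun s c =>
  (Classical.choose_spec (exists_max_image univ (classMass w syn S s) univ_nonempty)).2 c (mem_univ c)

/-- The **optimal failure mass** of the decoding problem `(w, syn, S)`: the failure mass of maximum-likelihood decoding,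
i.e. (below) the least failure mass over all decoders — for independent flips, the failure probability of "the optimal
way to recover", whose vanishing along a family defines DKLP's accuracy threshold `p_c`.
[cite: DennisEtAl2002, §4.3 eq. (ec_cond) and §4.6 (p_c)] -/
noncomputable def optimalFailureMass [Nonempty Err] : ℝ :=
  failureMass w syn S (mlDecoder w syn S)

open Classical in
/-- **No decoder beats the optimum**: `optimalFailureMass ≤ failureMass D` for every decoder `D`.
[cite: BravyiSucharaVargo2014, §1 (MLD is the optimal error correction algorithm)] -/
theorem optimalFailureMass_le [Nonempty Err] (D : Decoder Syn Err) :
    optimalFailureMass w syn S ≤ failureMass w syn S D :=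
  (isMaxLikelihood_mlDecoder w syn S).failureMass_le w syn S D

open Classical in
/-- Every ML decoder attains the optimum. [cite: BravyiSucharaVargo2014, §2 (any g ∈ C_ML^s)] -/
theorem optimalFailureMass_eq_of_isMaxLikelihood [Nonempty Err] {D : Decoder Syn Err}
    (hD : IsMaxLikelihood w syn S D) : optimalFailureMass w syn S = failureMass w syn S D :=
  (isMaxLikelihood_mlDecoder w syn S).failureMass_eq w syn S hD

open Classical in
/-- The optimum is attained: some (maximum-likelihood) decoder has exactly the optimal failure mass.
[cite: BravyiSucharaVargo2014, §2 (ML Decoder)] -/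
theorem exists_failureMass_eq_optimal [Nonempty Err] :
    ∃ D : Decoder Syn Err, IsMaxLikelihood w syn S D ∧ failureMass w syn S D = optimalFailureMass w syn S :=
  ⟨mlDecoder w syn S, isMaxLikelihood_mlDecoder w syn S, rfl⟩

open Classical in
/-- For non-negative weights the failure mass is non-negative. [cite: DennisEtAl2002, §4.3 eq. (ec_cond)] -/
theorem failureMass_nonneg {w : Err → ℝ} (hw : ∀ e, 0 ≤ w e) (D : Decoder Syn Err) :
    0 ≤ failureMass w syn S D :=
  sum_nonneg fun e _ => hw e

open Classical in
/-- For non-negative weights the failure mass is at most the total weight. [cite: DennisEtAl2002, §4.3 eq. (ec_cond)] -/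
theorem failureMass_le_sum {w : Err → ℝ} (hw : ∀ e, 0 ≤ w e) (D : Decoder Syn Err) :
    failureMass w syn S D ≤ ∑ e, w e := by
  rw [failureMass_eq_sub]
  have : 0 ≤ successMass w syn S D := sum_nonneg fun e _ => hw e
  linarith

open Classical in
/-- For non-negative weights: `0 ≤ optimalFailureMass`. [cite: DennisEtAl2002, §4.3 eq. (ec_cond)] -/
theorem optimalFailureMass_nonneg [Nonempty Err] {w : Err → ℝ} (hw : ∀ e, 0 ≤ w e) :
    0 ≤ optimalFailureMass w syn S :=
  failureMass_nonneg syn S hw _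

open Classical in
/-- For non-negative weights: `optimalFailureMass ≤ Σ w`. [cite: DennisEtAl2002, §4.3 eq. (ec_cond)] -/
theorem optimalFailureMass_le_sum [Nonempty Err] {w : Err → ℝ} (hw : ∀ e, 0 ≤ w e) :
    optimalFailureMass w syn S ≤ ∑ e, w e :=
  failureMass_le_sum syn S hw _

end Abstract

/-! ### Stabilizer subgroups: the class mass is a function of the coset -/

section Coset

universe u v

variable {Err : Type u} {Syn : Type v} [Fintype Err] [AddCommGroup Err]

open Classical in
/-- For a stabilizer SUBGROUP `S`, corrections in the same coset of `S` have the same class mass on every syndrome: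
the ML rule chooses a CLASS ("we should choose a recovery operator as any Pauli operator that belongs to the most
likely of the … cosets"). [cite: BravyiSucharaVargo2014, §2 (ML Decoder; any g ∈ C_ML^s)] -/
theorem classMass_eq_of_sub_mem (w : Err → ℝ) (syn : Err → Syn) (S : AddSubgroup Err) (s : Syn) {c c' : Err}
    (h : c - c' ∈ S) : classMass w syn (S : Set Err) s c = classMass w syn (S : Set Err) s c' := by
  unfold classMass
  refine sum_congr ?_ fun _ _ => rfl
  ext e
  simp only [mem_filter, mem_univ, true_and, SetLike.mem_coe]
  refine and_congr_right fun _ => ⟨fun hc => ?_, fun hc' => ?_⟩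
  · have := S.sub_mem hc h
    rwa [show c + e - (c - c') = c' + e by abel] at this
  · have := S.add_mem hc' h
    rwa [show c' + e + (c - c') = c + e by abel] at this

end Coset

end Decoder

/-! ### CSS sectors under independent flips: the optimal failure probability -/

section CSS

variable {RX RZ V : Type*} [Fintype V] [DecidableEq V]

/-- Normalisation over error VECTORS: `Σ_{e ∈ 𝔽₂^V} p^{|supp e|}(1-p)^{|V|-|supp e|} = 1` (the bijection `e ↦ supp e`
with the subsets of `V`). [cite: DennisEtAl2002, §4.4 eq. (prob_E)] -/
theorem sum_bernoulliWeight_supp (p : ℝ) : ∑ e : V → ZMod 2, bernoulliWeight p (supp e) = 1 := by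
  rw [← sum_bernoulliWeight (V := V) p]
  exact Finset.sum_nbij' supp vecOf (fun _ _ => mem_univ _) (fun _ _ => mem_univ _)
    (fun e _ => vecOf_supp e) (fun E _ => supp_vecOf E) (fun _ _ => rfl)

namespace CSSCode

/-- The **optimal `Z`-sector failure probability** of a CSS code under independent phase flips of rate `p`: the
failure probability of maximum-likelihood decoding of the `X`-syndrome `H^X e` (success iff the residual is a
`Z`-stabilizer, `∈ rs H^Z`) — the least failure probability over ALL decoders (`zOptimalFailure_le`), DKLP's
"optimal way to recover". [cite: DennisEtAl2002, §4.3 (the optimal way to recover) and §4.6 (p_c)] -/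
noncomputable def zOptimalFailure [Fintype RZ] (C : CSSCode RX RZ V) (p : ℝ) : ℝ :=
  Decoder.optimalFailureMass (fun e : V → ZMod 2 => bernoulliWeight p (supp e)) C.zSyndrome
    (C.rowSpZ : Set (V → ZMod 2))

/-- The **optimal `X`-sector failure probability** (independent bit flips of rate `p`, `Z`-syndrome `H^Z e`, success iff
the residual is in `rs H^X`). [cite: DennisEtAl2002, §4.3 (the optimal way to recover; X and Z errors are recovered separately, §4.1)] -/
noncomputable def xOptimalFailure [Fintype RX] (C : CSSCode RX RZ V) (p : ℝ) : ℝ :=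
  Decoder.optimalFailureMass (fun e : V → ZMod 2 => bernoulliWeight p (supp e)) C.xSyndrome
    (C.rowSpX : Set (V → ZMod 2))

/-- The `X`-sector optimum is the `Z`-sector optimum of the `X ↔ Z` exchanged code (definitional).
[cite: DennisEtAl2002, §4.1 (separate procedures for X and Z errors)] -/
theorem xOptimalFailure_eq_swap [Fintype RX] (C : CSSCode RX RZ V) (p : ℝ) : C.xOptimalFailure p = C.swap.zOptimalFailure p := rfl

open Classical in
/-- **No decoder beats the optimum** (`Z`-sector): for every decoder `D` of the `X`-syndrome,
`zOptimalFailure C p ≤ Σ_{e : D fails} p^{|e|}(1-p)^{n-|e|}`. [cite: BravyiSucharaVargo2014, §1 (MLD is the optimal error correction algorithm); DennisEtAl2002, §4.7 (a lower bound on p_c)] -/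
theorem zOptimalFailure_le [Fintype RZ] (C : CSSCode RX RZ V) (D : Decoder (RX → ZMod 2) (V → ZMod 2)) (p : ℝ) :
    C.zOptimalFailure p ≤ ∑ e ∈ univ.filter (fun e : V → ZMod 2 =>
        ¬ D.Corrects C.zSyndrome (C.rowSpZ : Set (V → ZMod 2)) e), bernoulliWeight p (supp e) :=
  Decoder.optimalFailureMass_le _ _ _ D

open Classical in
/-- **No decoder beats the optimum** (`X`-sector). [cite: BravyiSucharaVargo2014, §1 (MLD is the optimal error correction algorithm)] -/
theorem xOptimalFailure_le [Fintype RX] (C : CSSCode RX RZ V) (D : Decoder (RZ → ZMod 2) (V → ZMod 2)) (p : ℝ) :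
    C.xOptimalFailure p ≤ ∑ e ∈ univ.filter (fun e : V → ZMod 2 =>
        ¬ D.Corrects C.xSyndrome (C.rowSpX : Set (V → ZMod 2)) e), bernoulliWeight p (supp e) :=
  Decoder.optimalFailureMass_le _ _ _ D

open Classical in
/-- **The optimum is attained** (`Z`-sector): some maximum-likelihood decoder fails with probability exactly
`zOptimalFailure C p`. [cite: BravyiSucharaVargo2014, §2 (ML Decoder)] -/
theorem exists_zFailure_eq_zOptimalFailure [Fintype RZ] (C : CSSCode RX RZ V) (p : ℝ) :
    ∃ D : Decoder (RX → ZMod 2) (V → ZMod 2),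
      Decoder.IsMaxLikelihood (fun e : V → ZMod 2 => bernoulliWeight p (supp e)) C.zSyndrome
          (C.rowSpZ : Set (V → ZMod 2)) D ∧
        (∑ e ∈ univ.filter (fun e : V → ZMod 2 =>
          ¬ D.Corrects C.zSyndrome (C.rowSpZ : Set (V → ZMod 2)) e), bernoulliWeight p (supp e)) =
          C.zOptimalFailure p :=
  Decoder.exists_failureMass_eq_optimal _ _ _

open Classical in
/-- **The optimum is attained** (`X`-sector). [cite: BravyiSucharaVargo2014, §2 (ML Decoder)] -/
theorem exists_xFailure_eq_xOptimalFailure [Fintype RX] (C : CSSCode RX RZ V) (p : ℝ) :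
    ∃ D : Decoder (RZ → ZMod 2) (V → ZMod 2),
      Decoder.IsMaxLikelihood (fun e : V → ZMod 2 => bernoulliWeight p (supp e)) C.xSyndrome
          (C.rowSpX : Set (V → ZMod 2)) D ∧
        (∑ e ∈ univ.filter (fun e : V → ZMod 2 =>
          ¬ D.Corrects C.xSyndrome (C.rowSpX : Set (V → ZMod 2)) e), bernoulliWeight p (supp e)) =
          C.xOptimalFailure p :=
  Decoder.exists_failureMass_eq_optimal _ _ _

/-- `0 ≤ zOptimalFailure C p` for `0 ≤ p ≤ 1`. [cite: DennisEtAl2002, §4.3 eq. (ec_cond)] -/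
theorem zOptimalFailure_nonneg [Fintype RZ] (C : CSSCode RX RZ V) {p : ℝ} (hp0 : 0 ≤ p) (hp1 : p ≤ 1) :
    0 ≤ C.zOptimalFailure p :=
  Decoder.optimalFailureMass_nonneg _ _ fun e => bernoulliWeight_nonneg hp0 hp1 (supp e)

/-- `zOptimalFailure C p ≤ 1` for `0 ≤ p ≤ 1`. [cite: DennisEtAl2002, §4.3 eq. (ec_cond)] -/
theorem zOptimalFailure_le_one [Fintype RZ] (C : CSSCode RX RZ V) {p : ℝ} (hp0 : 0 ≤ p) (hp1 : p ≤ 1) :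
    C.zOptimalFailure p ≤ 1 := by
  have h := Decoder.optimalFailureMass_le_sum C.zSyndrome (C.rowSpZ : Set (V → ZMod 2))
    (w := fun e : V → ZMod 2 => bernoulliWeight p (supp e)) fun e => bernoulliWeight_nonneg hp0 hp1 (supp e)
  rw [sum_bernoulliWeight_supp] at h
  exact h

/-- `0 ≤ xOptimalFailure C p` for `0 ≤ p ≤ 1`. [cite: DennisEtAl2002, §4.3 eq. (ec_cond)] -/
theorem xOptimalFailure_nonneg [Fintype RX] (C : CSSCode RX RZ V) {p : ℝ} (hp0 : 0 ≤ p) (hp1 : p ≤ 1) :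
    0 ≤ C.xOptimalFailure p :=
  C.swap.zOptimalFailure_nonneg hp0 hp1

/-- `xOptimalFailure C p ≤ 1` for `0 ≤ p ≤ 1`. [cite: DennisEtAl2002, §4.3 eq. (ec_cond)] -/
theorem xOptimalFailure_le_one [Fintype RX] (C : CSSCode RX RZ V) {p : ℝ} (hp0 : 0 ≤ p) (hp1 : p ≤ 1) :
    C.xOptimalFailure p ≤ 1 :=
  C.swap.zOptimalFailure_le_one hp0 hp1

/-- **Erasure decomposition at the optimum**: `P^Z_{2p}[erasure uncorrectable] ≤ 2 · zOptimalFailure C p` for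
`0 ≤ p ≤ 1/2` — the bound holds for every decoder, in particular for a maximum-likelihood one.
[cite: RichardsonUrbanke2008, Lemma 4.78 (Erasure Decomposition Lemma)] -/
theorem zUncorrectableProb_le_two_mul_zOptimalFailure [Fintype RZ] (C : CSSCode RX RZ V) {p : ℝ} (hp0 : 0 ≤ p)
    (hp : p ≤ 1 / 2) :
    ErasureDecoder.uncorrectableProb {x | C.HX *ᵥ x = 0} (C.rowSpZ : Set (V → ZMod 2)) (2 * p) ≤
      2 * C.zOptimalFailure p := by
  obtain ⟨D, _, hD⟩ := C.exists_zFailure_eq_zOptimalFailure p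
  rw [← hD]
  exact C.zUncorrectableProb_two_mul_le D hp0 hp

/-- **Erasure decomposition at the optimum** (`X`-sector). [cite: RichardsonUrbanke2008, Lemma 4.78 (Erasure Decomposition Lemma)] -/
theorem xUncorrectableProb_le_two_mul_xOptimalFailure [Fintype RX] (C : CSSCode RX RZ V) {p : ℝ} (hp0 : 0 ≤ p)
    (hp : p ≤ 1 / 2) :
    ErasureDecoder.uncorrectableProb {x | C.HZ *ᵥ x = 0} (C.rowSpX : Set (V → ZMod 2)) (2 * p) ≤
      2 * C.xOptimalFailure p :=
  C.swap.zUncorrectableProb_le_two_mul_zOptimalFailure hp0 hp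

/-- **Complementary flip rates defeat the optimal decoders too** (`k ≥ 1`; `p, p' ≥ 0`, `p + p' = 1/2`):
`1/2 ≤ zOptimalFailure C p + xOptimalFailure C p'`. [cite: RichardsonUrbanke2008, Lemma 4.78; StaceBarrettDoherty2009, p. 2 (no-cloning bound)] -/
theorem half_le_zOptimalFailure_add_xOptimalFailure [Fintype RX] [Fintype RZ] (C : CSSCode RX RZ V) (hk : 0 < C.k) {p p' : ℝ}
    (hp0 : 0 ≤ p) (hp'0 : 0 ≤ p') (hsum : p + p' = 1 / 2) :
    1 / 2 ≤ C.zOptimalFailure p + C.xOptimalFailure p' := by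
  obtain ⟨DZ, _, hZ⟩ := C.exists_zFailure_eq_zOptimalFailure p
  obtain ⟨DX, _, hX⟩ := C.exists_xFailure_eq_xOptimalFailure p'
  rw [← hZ, ← hX]
  exact C.half_le_zFailure_add_xFailure hk DZ DX hp0 hp'0 hsum

/-- **At flip rate `1/2` even the optimal decoder fails with probability `≥ 1/2`** (`k ≥ 1`).
[cite: RichardsonUrbanke2008, Lemma 4.78 (Erasure Decomposition Lemma)] -/
theorem half_le_zOptimalFailure_half [Fintype RX] [Fintype RZ] (C : CSSCode RX RZ V) (hk : 0 < C.k) :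
    1 / 2 ≤ C.zOptimalFailure (1 / 2) := by
  obtain ⟨DZ, _, hZ⟩ := C.exists_zFailure_eq_zOptimalFailure (1 / 2)
  rw [← hZ]
  exact C.half_le_zFailure_half hk DZ

/-- **At flip rate `1/2` even the optimal `X`-decoder fails with probability `≥ 1/2`** (`k ≥ 1`).
[cite: RichardsonUrbanke2008, Lemma 4.78 (Erasure Decomposition Lemma)] -/
theorem half_le_xOptimalFailure_half [Fintype RX] [Fintype RZ] (C : CSSCode RX RZ V) (hk : 0 < C.k) :
    1 / 2 ≤ C.xOptimalFailure (1 / 2) := by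
  rw [xOptimalFailure_eq_swap]
  exact C.swap.half_le_zOptimalFailure_half (by rwa [k_swap])

/-- **The optimum is a permutation invariant**: re-indexing a CSS code along bijections of checks and qubits
(Lin–Pryadko permutation equivalence, the tree's `CSSCode.reindex`) leaves the optimal `Z`-sector failure probability
unchanged (every decoder of either code transports to a decoder of the other with the same failure probability,
`CSSCode.zFailure_reindex`). [cite: LinPryadko2024, §4.2 Thm 6 (permutation-equivalent codes) with DennisEtAl2002 §4.4 eq. (prob_E)] -/
theorem zOptimalFailure_reindex {RX' RZ' V' : Type*} [Fintype V'] [DecidableEq V'] [Fintype RZ] [Fintype RZ']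
    (C : CSSCode RX RZ V) (eX : RX ≃ RX') (eZ : RZ ≃ RZ') (eQ : V ≃ V') (p : ℝ) :
    (C.reindex eX eZ eQ).zOptimalFailure p = C.zOptimalFailure p := by
  apply le_antisymm
  · obtain ⟨D, _, hD⟩ := C.exists_zFailure_eq_zOptimalFailure p
    have h1 := (C.reindex eX eZ eQ).zOptimalFailure_le (fun s' => D (s' ∘ eX) ∘ eQ.symm) p
    rw [C.zFailure_reindex eX eZ eQ D p, hD] at h1
    exact h1
  · obtain ⟨D', _, hD'⟩ := (C.reindex eX eZ eQ).exists_zFailure_eq_zOptimalFailure p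
    have h2 := C.zOptimalFailure_le (fun s => D' (s ∘ eX.symm) ∘ eQ) p
    have h3 := C.zFailure_reindex eX eZ eQ (fun s => D' (s ∘ eX.symm) ∘ eQ) p
    have hD : (fun s' : RX' → ZMod 2 => (fun s => D' (s ∘ eX.symm) ∘ eQ) (s' ∘ eX) ∘ eQ.symm) = D' := by
      funext s'
      have hs : (s' ∘ ⇑eX) ∘ ⇑eX.symm = s' := by funext r; simp
      simp only [hs]
      funext q; simp
    rw [hD, hD'] at h3
    rw [← h3] at h2
    exact h2

end CSSCode

end CSS

end Literature.InformationTheory.QuantumCodes
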